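import Mathlib
import HarnessLib
import Summits.HubbardSuperconductivity.HubbardSuperconductivity.Theorems.KLProgrammeKLRegimeThinPairFlowData
import Summits.HubbardSuperconductivity.HubbardSuperconductivity.Theorems.KLProgrammeKLRegimeEngineSliceMeanFreeChain
import Summits.HubbardSuperconductivity.HubbardSuperconductivity.Theorems.KLProgrammeKLRegimeFrameOKDerivBounds

/-!
# K3 ENGINE child (stmt-HubbardSuperconductivity-20437), stub (b) (ℓ)/(I1′) below the deep window — the W2 (OVERLAP) twin of (D5), brick (W1):
# the frame class of two consecutive MEAN-FREE chain frames `K♯_i, K♯_{i+1}` and the two-scale data of their band increment in `U²` currency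

Cell `gate-hubbard-kl`, seat hubbard-kl-k3c3-p2 (g12); F1-W2-DESIGN §2 (W1).  The overlap telescope for E1's `cr/cc` below the deep window re-keys p3's
«W2H-OVL» per-piece lemma `charSumWt_thinPairDiff_le_piece` (…ThinPairFlowPiece) from the raw flow chain `K_i` (…ThinPairFlowData, 20440) to the
MEAN-FREE chain of (D5), `K♯_i := K_i ⊖ symInterp (Σ_{m ∈ Ico i n} mean_m)` (`mean_m = klAngularMean ν_m(K_m)`), whose consecutive band increments are the
mean-free flow pieces `r_i = piece_i − mean_i` (`frameLevel_meanFreeChain_succ_sub`) with order-0 size `c″U²16^{−i}` (`FlowPieceOscAt`, (K5′)) instead of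
`Gfr₀|U|16^{−i}` — the `U²` currency that makes the `(n − m₀)`-term sum of the telescope `≤ const·cc` (design memo §1).  This file = the twins of
`thinPair_flow_frames` / `thinPair_flow_piece`:

* **`meanFree_flow_frames`** — for `1 ≤ i`, `i + 1 ≤ n`: `FrameOK R♭ U n_β μ K♯_i`, `FrameOK R♭ U n_β μ K♭_{i+1}` with the bumped package
  `R♭ = ⟨cr, cz, Gfr[0 ↦ Gfr₀ + cr·e₀]⟩` (p3 `frameOK_meanFreeBase`), the third sizes `‖D³ frameShift K♯_i‖ ≤ Gfr₃U²·4^i/3` (resp. `4^{i+1}/3`;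
  `norm_iteratedFDeriv_three_meanFreeChain_le`), the curvatures `‖D² frameLevel μ K♯‖ ≤ 7` of both, and the piece's jets `FlowPieceJetsAt … i`;
* **`meanFree_flow_piece`** — the band increment `ν♯ = e_{K♯_i} − e_{K♯_{i+1}}` on `Fin 2 → ℝ` in the rate atoms' normalisation: `ContDiff ℝ 3 ν♯`,
  `|ν♯| ≤ G₀/x²`, `‖Dν♯‖ ≤ 2G₀/x`, `‖D²ν♯‖ ≤ 4G₀`, `‖D³ν♯‖ ≤ 8G₀·x` (`x = 4^i`) for ANY `G₀ ≥ (c″ + Gfr₁ + Gfr₂ + Gfr₃)·U²`, and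
  `frameDist K♯_i K♯_{i+1} ≤ G₀/x²` — from `FlowPieceJetsAt … i` (orders ≥ 1) and `FlowPieceOscAt … c″ … i` (order 0).

Everything is proved; no definitions; nothing about the model is asserted; nothing asserts superconductivity. [cite: BenfattoGiulianiMastropietro2006, §2.4 (2.36), §3 (3.2)]
-/

noncomputable section

namespace Summit.HubbardSuperconductivity.HubbardSuperconductivity.Theorems.TorusFourierL2

set_option linter.dupNamespace false -- summit = problem name (single-conjunct summit), D-0017

open Set Finset Literature.MathematicalPhysics.QuantumLattice Literature.MathematicalPhysics.QuantumLattice.BandSectorCounting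
open Literature.MathematicalPhysics.QuantumLattice.FermiRG Literature.Probability.LatticeModels
open Summit.HubbardSuperconductivity.HubbardSuperconductivity.Theorems.DispersionFlow
open Summit.HubbardSuperconductivity.HubbardSuperconductivity.Theorems.KLRegimeSplit
open Summit.HubbardSuperconductivity.HubbardSuperconductivity.Theorems.KLProgrammeLegKernels
open Summit.HubbardSuperconductivity.HubbardSuperconductivity.Theorems.PerturbedFermiCurve
open scoped Real

variable {L M : ℕ} [NeZero L] [NeZero M]

/-- **The frame class of two consecutive mean-free chain frames from the history** (see the module docstring). [cite: BenfattoGiulianiMastropietro2006, §3 (3.2)] -/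
theorem meanFree_flow_frames {G : GeoConsts} {P : SplitConsts} {Q : EngConsts} {R : RenConsts} (hR2 : R.WF2) {β U μ cc : ℝ}
    (hμ : μ ∈ klWindowC) (hU : 0 < U) (hU1 : U ≤ 1) (hUd : U ≤ 1 / (2 ^ 12 * (R.Gfr 0 + R.Gfr 1 + R.cr + 1)))
    (hcc : 0 ≤ cc) (hcc2 : cc ≤ 1 / (480 * (R.Gfr 2 + 1))) {n : ℕ} (hreg : IsKLRegime U cc (-(n : ℤ)))
    (hnN : n ≤ nScales β + 1) (hhist : HistP klPredsV17F2 L M G P Q R β U μ 0 n) {i : ℕ} (hi1 : 1 ≤ i) (hin : i + 1 ≤ n) :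
    FrameOK ⟨R.cr, R.cz, fun j => if j = 0 then R.Gfr 0 + R.cr * klE0 else R.Gfr j⟩ U (nScales β) μ
        (fsub (klFlowFrameU L M β U μ i) (symInterp L fun _ =>
          ∑ m ∈ Ico i n, klAngularMean (klLocalPart L M β U μ (klFlowFrameU L M β U μ m) m))) ∧
      FrameOK ⟨R.cr, R.cz, fun j => if j = 0 then R.Gfr 0 + R.cr * klE0 else R.Gfr j⟩ U (nScales β) μ
        (fsub (klFlowFrameU L M β U μ (i + 1)) (symInterp L fun _ =>
          ∑ m ∈ Ico (i + 1) n, klAngularMean (klLocalPart L M β U μ (klFlowFrameU L M β U μ m) m))) ∧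
      (∀ p : Momentum, ‖iteratedFDeriv ℝ 3 (frameShift (fsub (klFlowFrameU L M β U μ i) (symInterp L fun _ =>
          ∑ m ∈ Ico i n, klAngularMean (klLocalPart L M β U μ (klFlowFrameU L M β U μ m) m)))) p‖ ≤ R.Gfr 3 * U ^ 2 * ((4 : ℝ) ^ i / 3)) ∧
      (∀ p : Momentum, ‖iteratedFDeriv ℝ 3 (frameShift (fsub (klFlowFrameU L M β U μ (i + 1)) (symInterp L fun _ =>
          ∑ m ∈ Ico (i + 1) n, klAngularMean (klLocalPart L M β U μ (klFlowFrameU L M β U μ m) m)))) p‖ ≤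
        R.Gfr 3 * U ^ 2 * ((4 : ℝ) ^ (i + 1) / 3)) ∧
      (∀ p : Momentum, ‖iteratedFDeriv ℝ 2 (frameLevel μ (fsub (klFlowFrameU L M β U μ i) (symInterp L fun _ =>
          ∑ m ∈ Ico i n, klAngularMean (klLocalPart L M β U μ (klFlowFrameU L M β U μ m) m)))) p‖ ≤ 7) ∧
      (∀ p : Momentum, ‖iteratedFDeriv ℝ 2 (frameLevel μ (fsub (klFlowFrameU L M β U μ (i + 1)) (symInterp L fun _ =>
          ∑ m ∈ Ico (i + 1) n, klAngularMean (klLocalPart L M β U μ (klFlowFrameU L M β U μ m) m)))) p‖ ≤ 7) ∧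
      FlowPieceJetsAt L M β U μ R i := by
  have hRj : ∀ j, 0 ≤ R.Gfr j := EngineV8.gfr_nonneg_of_wf2 hR2
  have hh := (histP_klPredsV17F2_iff L M G P Q R β U μ 0 n).1 hhist
  have hJ : ∀ m ≤ i, FlowPieceJetsAt L M β U μ R m := fun m hm => (hh m (by omega)).2.1.2.1
  have hfr1 := frameOK_meanFreeBase (L := L) (M := M) hR2 hμ hU hU1 hUd hcc hcc2 hreg hi1 (by omega) hnN hhist
  have hfr2 := frameOK_meanFreeBase (L := L) (M := M) hR2 hμ hU hU1 hUd hcc hcc2 hreg (show 1 ≤ i + 1 by omega) hin hnN hhist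
  have h3 := fun p => (norm_iteratedFDeriv_three_meanFreeChain_le (L := L) (M := M) (β := β) (U := U) (μ := μ) (n := n) (i := i) hRj
    (fun m' hm' => hJ m' hm'.le) p).1
  have h3' := fun p => (norm_iteratedFDeriv_three_meanFreeChain_le (L := L) (M := M) (β := β) (U := U) (μ := μ) (n := n) (i := i + 1) hRj
    (fun m' hm' => hJ m' (by omega)) p).1
  refine ⟨hfr1, hfr2, fun p => (h3 p).trans_eq (by ring), fun p => (h3' p).trans_eq (by ring),
    fun p => norm_iteratedFDeriv_two_frameLevel_le_of_frameOK hfr1 p, fun p => norm_iteratedFDeriv_two_frameLevel_le_of_frameOK hfr2 p, hJ i le_rfl⟩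

/-- **The band increment of one MEAN-FREE chain step in the rate atoms' normalisation**: for `ν♯ = e_{K♯_i} − e_{K♯_{i+1}}` (Pi side), `x = 4^i`,
`0 ≤ c″` and any `G₀ ≥ (c″ + Gfr₁ + Gfr₂ + Gfr₃)·U²`: `ContDiff ℝ 3 ν♯`, `|ν♯| ≤ G₀/x²`, `‖Dν♯‖ ≤ 2G₀/x`, `‖D²ν♯‖ ≤ 4G₀`, `‖D³ν♯‖ ≤ 8G₀·x`, and
`frameDist K♯_i K♯_{i+1} ≤ G₀/x²` — order 0 from `FlowPieceOscAt` (the `U²` currency), orders 1–3 from `FlowPieceJetsAt`.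
[cite: BenfattoGiulianiMastropietro2006, §2.4 (2.36), §3 (3.2)] -/
theorem meanFree_flow_piece {β U μ c'' : ℝ} {R : RenConsts} (hRj : ∀ j, 0 ≤ R.Gfr j) (hc : 0 ≤ c'') {i n : ℕ} (hin : i < n)
    (hJ : FlowPieceJetsAt L M β U μ R i) (hO : FlowPieceOscAt L M c'' β U μ i) {x : ℝ} (hx : x = (4 : ℝ) ^ i) {G₀ : ℝ}
    (hG : (c'' + R.Gfr 1 + R.Gfr 2 + R.Gfr 3) * U ^ 2 ≤ G₀) {ν : (Fin 2 → ℝ) → ℝ}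
    (hν : ∀ p, ν p = frameLevel μ (fsub (klFlowFrameU L M β U μ i) (symInterp L fun _ =>
          ∑ m ∈ Ico i n, klAngularMean (klLocalPart L M β U μ (klFlowFrameU L M β U μ m) m))) (WithLp.toLp 2 p) -
        frameLevel μ (fsub (klFlowFrameU L M β U μ (i + 1)) (symInterp L fun _ =>
          ∑ m ∈ Ico (i + 1) n, klAngularMean (klLocalPart L M β U μ (klFlowFrameU L M β U μ m) m))) (WithLp.toLp 2 p)) :
    ContDiff ℝ 3 ν ∧ (∀ p, |ν p| ≤ G₀ / x ^ 2) ∧ (∀ p, ‖fderiv ℝ ν p‖ ≤ 2 * G₀ / x) ∧ (∀ p, ‖iteratedFDeriv ℝ 2 ν p‖ ≤ 4 * G₀) ∧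
      (∀ p, ‖iteratedFDeriv ℝ 3 ν p‖ ≤ 8 * G₀ * x) ∧
      frameDist (fsub (klFlowFrameU L M β U μ i) (symInterp L fun _ =>
          ∑ m ∈ Ico i n, klAngularMean (klLocalPart L M β U μ (klFlowFrameU L M β U μ m) m)))
        (fsub (klFlowFrameU L M β U μ (i + 1)) (symInterp L fun _ =>
          ∑ m ∈ Ico (i + 1) n, klAngularMean (klLocalPart L M β U μ (klFlowFrameU L M β U μ m) m))) ≤ G₀ / x ^ 2 := by
  have hx0 : 0 < x := by rw [hx]; positivity
  -- the mean-free piece on `Momentum` and its jets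
  set f : Momentum → ℝ := fun q => evalM (klFlowPiece L M β U μ i) q -
    klAngularMean (klLocalPart L M β U μ (klFlowFrameU L M β U μ i) i) with hf
  have hfC : ∀ {k : WithTop ℕ∞}, ContDiff ℝ k f := fun {k} => (contDiff_evalM _).sub contDiff_const
  have hsub := frameLevel_meanFreeChain_succ_sub (L := L) (M := M) β U μ hin
  have hνf : ν = fun p : Fin 2 → ℝ => -f (WithLp.toLp 2 p) := by
    funext p
    have e := congrFun hsub (WithLp.toLp 2 p)
    simp only at e
    rw [hν p, hf]
    simp only
    linarith only [e]
  have hjet : ∀ {j : ℕ}, j ≤ 4 → ∀ q, ‖iteratedFDeriv ℝ j f q‖ ≤ (if j = 0 then c'' * |U| else R.Gfr j) * uPow j U * (4 : ℝ) ^ (((j : ℤ) - 2) * (i : ℤ)) :=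
    fun {j} hj q => hO.pieceClause hJ hj q
  -- the exponents and the `uPow`s
  have e0 : (4 : ℝ) ^ ((((0 : ℕ) : ℤ) - 2) * (i : ℤ)) = 1 / x ^ 2 := by
    rw [hx, Nat.cast_zero, zero_sub, show (-2 : ℤ) * (i : ℤ) = -((i * 2 : ℕ) : ℤ) by push_cast; ring, zpow_neg, zpow_natCast, pow_mul, one_div]
  have e1 : (4 : ℝ) ^ ((((1 : ℕ) : ℤ) - 2) * (i : ℤ)) = 1 / x := by
    rw [hx, Nat.cast_one, show ((1 : ℤ) - 2) * (i : ℤ) = -(i : ℤ) by ring, zpow_neg, zpow_natCast, one_div]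
  have e2 : (4 : ℝ) ^ ((((2 : ℕ) : ℤ) - 2) * (i : ℤ)) = 1 := by rw [Nat.cast_ofNat, sub_self, zero_mul, zpow_zero]
  have e3 : (4 : ℝ) ^ ((((3 : ℕ) : ℤ) - 2) * (i : ℤ)) = x := by
    rw [hx, Nat.cast_ofNat, show ((3 : ℤ) - 2) * (i : ℤ) = (i : ℤ) by ring, zpow_natCast]
  have hu0 : uPow 0 U = |U| := by simp [uPow]
  have hu : ∀ j, 1 ≤ j → uPow j U = U ^ 2 := fun j hj => by simp [uPow, show j ≠ 0 by omega]
  have hUU : |U| * |U| = U ^ 2 := by rw [← sq_abs, pow_two]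
  have hU2 : 0 ≤ U ^ 2 := sq_nonneg U
  have h1' := hRj 1; have h2' := hRj 2; have h3' := hRj 3
  have hG0 : c'' * U ^ 2 ≤ G₀ := by nlinarith only [hG, h1', h2', h3', hU2]
  have hG1 : R.Gfr 1 * U ^ 2 ≤ G₀ := by nlinarith only [hG, hc, h1', h2', h3', hU2]
  have hG2 : R.Gfr 2 * U ^ 2 ≤ G₀ := by nlinarith only [hG, hc, h1', h2', h3', hU2]
  have hG3 : R.Gfr 3 * U ^ 2 ≤ G₀ := by nlinarith only [hG, hc, h1', h2', h3', hU2]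
  -- the Momentum-side bounds in the `G₀` normalisation
  have hb0 : ∀ q, |f q| ≤ G₀ / x ^ 2 := fun q => by
    have h := hjet (j := 0) (by norm_num) q
    rw [norm_iteratedFDeriv_zero, Real.norm_eq_abs, if_pos rfl, e0, hu0, mul_assoc (c''), hUU] at h
    refine h.trans ?_
    rw [mul_one_div]
    exact div_le_div_of_nonneg_right hG0 (by positivity)
  have hb1 : ∀ q, ‖iteratedFDeriv ℝ 1 f q‖ ≤ G₀ / x := fun q => by
    have h := hjet (j := 1) (by norm_num) q
    rw [if_neg one_ne_zero, e1, hu 1 le_rfl, mul_one_div] at h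
    exact h.trans (div_le_div_of_nonneg_right hG1 hx0.le)
  have hb2 : ∀ q, ‖iteratedFDeriv ℝ 2 f q‖ ≤ G₀ := fun q => by
    have h := hjet (j := 2) (by norm_num) q
    rw [if_neg (by norm_num), e2, hu 2 (by norm_num), mul_one] at h
    exact h.trans hG2
  have hb3 : ∀ q, ‖iteratedFDeriv ℝ 3 f q‖ ≤ G₀ * x := fun q => by
    have h := hjet (j := 3) (by norm_num) q
    rw [if_neg (by norm_num), e3, hu 3 (by norm_num)] at h
    exact h.trans (mul_le_mul_of_nonneg_right hG3 hx0.le)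
  -- the Pi side: `ν = −(f ∘ toLp)`
  set g : (Fin 2 → ℝ) → ℝ := fun p => f (WithLp.toLp 2 p) with hg
  have hνg : ν = -g := by rw [hνf]; rfl
  have hgC : ContDiff ℝ 3 g := hfC.comp (PiLp.contDiff_toLp)
  refine ⟨by rw [hνg]; exact hgC.neg, fun p => ?_, fun p => ?_, fun p => ?_, fun p => ?_, ?_⟩
  · rw [hνg, Pi.neg_apply, abs_neg]; exact hb0 _
  · rw [hνg, fderiv_neg, norm_neg]
    have h := norm_iteratedFDeriv_comp_toLp_le (hfC (k := 1)) hb1 p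
    rw [norm_iteratedFDeriv_one] at h
    refine h.trans_eq ?_
    ring
  · rw [hνg, iteratedFDeriv_neg_apply, norm_neg]
    exact (norm_iteratedFDeriv_comp_toLp_le (hfC (k := 2)) hb2 p).trans_eq (by ring)
  · rw [hνg, iteratedFDeriv_neg_apply, norm_neg]
    exact (norm_iteratedFDeriv_comp_toLp_le (hfC (k := 3)) hb3 p).trans_eq (by ring)
  · refine frameDist_le_of_forall fun p => ?_
    have e := hν p
    rw [EngineV8.frameLevel_eq_zero_sub_evalM μ (fsub (klFlowFrameU L M β U μ i) _),
      EngineV8.frameLevel_eq_zero_sub_evalM μ (fsub (klFlowFrameU L M β U μ (i + 1)) _)] at e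
    have e' : ν p = -((fsub (klFlowFrameU L M β U μ i) (symInterp L fun _ =>
          ∑ m ∈ Ico i n, klAngularMean (klLocalPart L M β U μ (klFlowFrameU L M β U μ m) m))).eval p -
        (fsub (klFlowFrameU L M β U μ (i + 1)) (symInterp L fun _ =>
          ∑ m ∈ Ico (i + 1) n, klAngularMean (klLocalPart L M β U μ (klFlowFrameU L M β U μ m) m))).eval p) := by
      rw [e]; simp only [evalM]; ring
    have h := hb0 (WithLp.toLp 2 p)
    have hνp : |ν p| ≤ G₀ / x ^ 2 := by rw [hνf]; simp only [abs_neg]; exact h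
    rw [e', abs_neg] at hνp
    exact hνp

end Summit.HubbardSuperconductivity.HubbardSuperconductivity.Theorems.TorusFourierL2

end
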